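import Literature.Barriers.HodgeConjecture.IntegralCoefficientsKollarCurves
import Literature.AlgebraicGeometry.HodgeTheory.ZariskiClosedStraightening
import Literature.NumberTheory.Transcendental.AnalytificationConnectedOpen
import Literature.AlgebraicTopology.SingularHomology.RelativeCochains
import HarnessLib

/-!
# Kollár (1992): purity for one irreducible curve, reduced to the cyclicity of one relative
# cohomology group of the straightened smooth locus

Sibling of `Literature/Barriers/HodgeConjecture/IntegralCoefficientsKollarCurves`, which reduces
hypothesis (i) of the Kollár reduction (`Kollar1992_nonTorsionClass_notAlgebraic_of_ker_le_span`)
to irreducible curves: (i') for every irreducible closed curve `C ⊆ X` on the smooth projective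
threefold `X`, `ker (H⁴(X(ℂ); ℤ) → H⁴((X ∖ C)(ℂ); ℤ)) ≤ ℤ · (p • α)`. In print (Soulé–Voisin
2005, §2; Fulton 1998, §19.1 Lemma 19.1.1) this kernel is `ℤ · cl(C)` — PURITY for one curve —
with `cl(C) = (deg C) α` and `p ∣ deg C` (Kollár). This file isolates the TOPOLOGICAL content of
purity as one statement about ONE relative cohomology group, everything else being proved:

* `ker_restrictComplInt_le_span_of_relSingularCohomology_cyclic` — for `X` smooth projective of
  dimension `n`, `Z₁ ⊆ C ⊆ X` with `Z₁` finite, and `2 ≤ k ≤ 2n - 2`: IF the relative cohomology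
  `Hᵏ(U, U ∖ S; ℤ)` of the open subset `U = (X ∖ Z₁)(ℂ)` of `X(ℂ)` modulo `U ∖ S = (X ∖ C)(ℂ)`
  (`S = {P | pt P ∈ C ∖ Z₁}`, closed in `U`) is a CYCLIC group, then
  `ker (Hᵏ(X(ℂ);ℤ) → Hᵏ((X ∖ C)(ℂ);ℤ)) ≤ ℤ · τ` for one class `τ` — the long exact sequence of the
  pair (Hatcher §3.1 p. 200, the tree's `relSingularCohomology.exact_toAbsolute_map`) and the
  bijectivity of `Hᵏ(X(ℂ)) → Hᵏ(U)` across finitely many punctures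
  (`restrictComplInt_bijective_of_finite`);
* `ker_restrictComplInt_le_span_of_straightened_cyclic` — for an irreducible closed curve `C` on
  a smooth projective threefold: the tree PROVES (Serre, GAGA §6 Cor. 3 at simple points; Voisin I
  Thm. 11.11; `HodgeTheory.GAGADimension.exists_closed_straightening_off`) that off a finite set
  `Z₁ ⊆ C` of closed points the subset `C(ℂ)` of the `6`-manifold `X(ℂ)` is straightened by charts
  `X(ℂ) ⇀ ℂ^{c'} × K`, `c' ≥ 2`, and (`ComplexPoints.isConnected_setOf_pt_mem_diff_of_isIrreducible`,
  Shafarevich VII §2 Thm. 7.1) that `S = (C ∖ Z₁)(ℂ)` is connected; so IF for every such `Z₁` the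
  group `H⁴(U, U ∖ S; ℤ)` is cyclic — the Thom isomorphism `H⁴(U, U ∖ S; ℤ) ≅ H⁰(S; ℤ) = ℤ` of the
  closed complex submanifold `S` of the open `U` (Voisin I §11.1.2, proof of Lemma 11.13; Milnor–
  Stasheff §10), NOT in the tree — then `ker (H⁴(X(ℂ);ℤ) → H⁴((X ∖ C)(ℂ);ℤ)) ≤ ℤ · τ_C`.

So the purity half of (i') is reduced to a single topological statement (cyclicity of the degree-
`2c` relative cohomology of a connected, straightened, closed subset of real codimension `2c` of a
manifold), for the engines `AlgebraicTopology/SingularHomology/{HighCodimensionComplement,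
LocallyFlatComplement}` (which give the vanishing below degree `2c`); the other halves of (i') are
`τ_C = (deg C) α` (integral Lefschetz) and Kollár's `p ∣ deg C`. Everything here is proved; no
named facts.

## References

* [SouleVoisin2005] C. Soulé, C. Voisin, Adv. Math. 198 (2005), §2 and Thm. 2.
* [KollarTrento1992] J. Kollár, Trento examples §1, Lemma p. 134, LNM 1515 (1992).
* [Fulton1998] W. Fulton, Intersection Theory, §19.1 Lemma 19.1.1.
* [VoisinHodgeI2002] C. Voisin, Hodge Theory and Complex Algebraic Geometry I, §11.1.1 Thm. 11.11,
  §11.1.2 Lemma 11.13.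
* [HatcherAT2002] A. Hatcher, Algebraic Topology, CUP 2002, §3.1 p. 200, §3.3 p. 231.
* [SerreGAGA1956] J.-P. Serre, GAGA, Ann. Inst. Fourier 6 (1956), §6 Prop. 3 Cor. 3.
* [Shafarevich1994] I. R. Shafarevich, Basic Algebraic Geometry 2, VII §2 Thm. 7.1.
-/

noncomputable section

open CategoryTheory AlgebraicGeometry Set Topology
open Literature.AlgebraicTopology.SingularHomology Literature.AlgebraicGeometry.Motives

namespace Literature.Barriers.HodgeConjecture

section Barriers
section HodgeConjecture

variable {n : ℕ} {X : SchemeOver ℂ}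

/-- **Kernels of restrictions from the relative cohomology of the punctured pair.** Let `X` be
smooth projective of dimension `n ≥ 1` over `ℂ`, `Z₁ ⊆ C ⊆ X` with `Z₁` finite, `2 ≤ k`,
`k, k + 1 ≠ 2n`; put `U = (X ∖ Z₁)(ℂ)` (an open subset of `X(ℂ)`) and `U ∖ S = (X ∖ C)(ℂ) ⊆ U`.
If the relative cohomology `Hᵏ(U, U ∖ S; ℤ)` is cyclic, then
`ker (Hᵏ(X(ℂ);ℤ) → Hᵏ((X ∖ C)(ℂ);ℤ)) ≤ ℤ · τ` for one class `τ ∈ Hᵏ(X(ℂ); ℤ)`: by exactness of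
`Hᵏ(U, U ∖ S) → Hᵏ(U) → Hᵏ(U ∖ S)` (Hatcher 2002, §3.1 p. 200) the classes on `U` dying on `U ∖ S`
are multiples of the image `τ₀` of a generator, and `Hᵏ(X(ℂ)) → Hᵏ(U)` is bijective
(`restrictComplInt_bijective_of_finite`, Hatcher §3.3 p. 231), so `τ` is the class extending `τ₀`.
[cite: HatcherAT2002, §3.1 p. 200 and §3.3 p. 231] [cite: GrothendieckTopology1969, §1] -/
theorem ker_restrictComplInt_le_span_of_relSingularCohomology_cyclic
    (hX : IsSmoothProjective n X) (hn : 1 ≤ n) {C Z₁ : Set X.left} (hZ₁C : Z₁ ⊆ C)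
    (hZ₁ : Z₁.Finite) {k : ℕ} (hk : 2 ≤ k) (hkn : k ≠ 2 * n) (hkn' : k + 1 ≠ 2 * n)
    (hcyc : ∃ θ : relSingularCohomology ℤ ℤ (complexPointsCompl X Z₁)
        {Q : complexPointsCompl X Z₁ | Q.1.pt ∉ C} k,
      ∀ y, y ∈ Submodule.span ℤ ({θ} : Set (relSingularCohomology ℤ ℤ (complexPointsCompl X Z₁)
        {Q : complexPointsCompl X Z₁ | Q.1.pt ∉ C} k))) :
    ∃ τ : bettiCohomologyInt X k,
      LinearMap.ker (restrictComplInt X C k).hom ≤ Submodule.span ℤ {τ} := by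
  -- the pair `(U, U ∖ S)`: `U = (X ∖ Z₁)(ℂ)`, `U ∖ S = (X ∖ C)(ℂ)`
  let A : Set (complexPointsCompl X Z₁) := {Q | Q.1.pt ∉ C}
  -- `U ∖ S` is `(X ∖ C)(ℂ)`
  let e : ↥A ≃ₜ complexPointsCompl X C :=
    { toFun := fun Q ↦ ⟨Q.1.1, Q.2⟩
      invFun := fun P ↦ ⟨⟨P.1, fun h ↦ P.2 (hZ₁C h)⟩, P.2⟩
      left_inv := fun Q ↦ rfl
      right_inv := fun P ↦ rfl
      continuous_toFun := by fun_prop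
      continuous_invFun := by fun_prop }
  have hfac : restrictComplInt X C k = restrictComplInt X Z₁ k ≫
      singularCohomology.map ℤ ℤ (subsetIncl A) k ≫
        singularCohomology.map ℤ ℤ (e.symm : C(complexPointsCompl X C, ↥A)) k := by
    rw [restrictComplInt, restrictComplInt, ← singularCohomology.map_comp,
      ← singularCohomology.map_comp]
    rfl
  have hbij := restrictComplInt_bijective_of_finite hX hn hZ₁ hk hkn hkn'
  have heinj : Function.Injective
      (singularCohomology.map ℤ ℤ (e.symm : C(complexPointsCompl X C, ↥A)) k) :=
    ((forget (ModuleCat ℤ)).mapIso (singularCohomology.mapIso ℤ ℤ e.symm k)).toEquiv.injective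
  obtain ⟨θ, hθ⟩ := hcyc
  -- the generator, read in `Hᵏ(X(ℂ); ℤ)`
  obtain ⟨τ, hτ⟩ := hbij.2 (relSingularCohomology.toAbsolute ℤ ℤ (complexPointsCompl X Z₁) A k θ)
  refine ⟨τ, fun x hx ↦ ?_⟩
  have hx' : restrictComplInt X C k x = 0 := hx
  -- `x|_U` dies on `U ∖ S`
  have h1 : singularCohomology.map ℤ ℤ (subsetIncl A) k (restrictComplInt X Z₁ k x) = 0 := by
    apply heinj
    rw [map_zero, ← ModuleCat.comp_apply, ← ModuleCat.comp_apply, ← hfac]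
    exact hx'
  -- hence comes from `Hᵏ(U, U ∖ S)`, a multiple of `θ`
  obtain ⟨y, hy⟩ := ((ShortComplex.moduleCat_exact_iff _).1
    (relSingularCohomology.exact_toAbsolute_map (R := ℤ) (M := ℤ) A k)) _ h1
  -- smul-free bookkeeping with spans (the `ℤ`-module structures of `ModuleCat` objects)
  set f := (restrictComplInt X Z₁ k).hom with hf
  set g := (relSingularCohomology.toAbsolute ℤ ℤ (complexPointsCompl X Z₁) A k).hom with hg
  have e1 : g y = f x := hy
  have e2 : g θ = f τ := hτ.symm
  have hy' : g y ∈ (Submodule.span ℤ {θ}).map g := Submodule.mem_map_of_mem (hθ y)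
  rw [Submodule.map_span, Set.image_singleton, e1, e2, ← Set.image_singleton,
    ← Submodule.map_span] at hy'
  obtain ⟨x', hx'mem, hx'eq⟩ := Submodule.mem_map.1 hy'
  have hxx : x' = x := hbij.1 hx'eq
  rw [← hxx]
  exact hx'mem

/-- **Purity for one irreducible curve, reduced to the cyclicity of `H⁴(U, U ∖ S; ℤ)` for the
straightened smooth part `S` of the curve.** Let `X/ℂ` be a smooth projective threefold and
`C ⊆ X` an irreducible closed curve (all points of codimension `≥ 2`, some point of codimension `2`).
The tree proves that there is a Zariski-closed `Z₁ ⊆ C` of codimension `≥ 3` — a finite set of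
closed points (`finite_of_isClosed_of_le_coheight`) — off which `C(ℂ) ⊆ X(ℂ)` is straightened by
open partial homeomorphisms `X(ℂ) ⇀ ℂ^{c'} × K`, `2 ≤ c'` (Serre, GAGA §6 Cor. 3 at simple points,
`HodgeTheory.GAGADimension.exists_closed_straightening_off`), and that `S = (C ∖ Z₁)(ℂ)` is connected
(Shafarevich VII §2 Thm. 7.1, `ComplexPoints.isConnected_setOf_pt_mem_diff_of_isIrreducible`). Hence:
IF for every finite set `Z₁ ⊆ C` of closed points off which `C(ℂ)` is so straightened and with
`(C ∖ Z₁)(ℂ)` connected, the group `H⁴(U, U ∖ S; ℤ)` (`U = (X ∖ Z₁)(ℂ)`) is cyclic — the Thom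
isomorphism `H⁴(U, U ∖ S; ℤ) ≅ H⁰(S; ℤ) = ℤ` for the closed complex submanifold `S` of `U`
[cite: VoisinHodgeI2002, §11.1.2 proof of Lemma 11.13], the one topological input NOT in the tree —
THEN `ker (H⁴(X(ℂ);ℤ) → H⁴((X ∖ C)(ℂ);ℤ)) ≤ ℤ · τ_C` for one class `τ_C` (in print `τ_C = cl(C)`,
Fulton 1998, §19.1 Lemma 19.1.1). With `τ_C = (deg C) α` and Kollár's `p ∣ deg C` this is
hypothesis (i') of `Kollar1992_nonTorsionClass_notAlgebraic_of_ker_le_span_of_curves`.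
[cite: SerreGAGA1956, §6 Prop. 3 Cor. 3] [cite: Shafarevich1994, Book 3 Ch. VII §2 Thm. 7.1]
[cite: Fulton1998, §19.1 Lemma 19.1.1] [cite: SouleVoisin2005, §2 Thm. 2]
[cite: KollarTrento1992, §1 Lemma p. 134] -/
theorem ker_restrictComplInt_le_span_of_straightened_cyclic (hX : IsSmoothProjective 3 X)
    {C : Set X.left} (hC : IsClosed C) (hCi : IsIrreducible C)
    (hC2 : ∀ z ∈ C, ((2 : ℕ) : ℕ∞) ≤ Order.coheight z) (hCx : ∃ z ∈ C, Order.coheight z = (2 : ℕ))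
    (htop : ∀ Z₁ : Set X.left, IsClosed Z₁ → Z₁ ⊆ C → Z₁.Finite →
      (∀ z ∈ Z₁, IsClosed ({z} : Set X.left)) →
      (∀ P : ComplexPoints X, P.pt ∈ C → P.pt ∉ Z₁ →
        ∃ (c' : ℕ) (K : Submodule ℂ (Fin 3 → ℂ))
          (e : OpenPartialHomeomorph (ComplexPoints X) ((Fin c' → ℂ) × K)),
          2 ≤ c' ∧ P ∈ e.source ∧ ∀ Q ∈ e.source, Q.pt ∈ C ↔ (e Q).1 = 0) →
      IsConnected {P : ComplexPoints X | P.pt ∈ C ∧ P.pt ∉ Z₁} →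
      ∃ θ : relSingularCohomology ℤ ℤ (complexPointsCompl X Z₁)
          {Q : complexPointsCompl X Z₁ | Q.1.pt ∉ C} (2 * 2),
        ∀ y, y ∈ Submodule.span ℤ ({θ} : Set (relSingularCohomology ℤ ℤ (complexPointsCompl X Z₁)
          {Q : complexPointsCompl X Z₁ | Q.1.pt ∉ C} (2 * 2)))) :
    ∃ τ : bettiCohomologyInt X (2 * 2),
      LinearMap.ker (restrictComplInt X C (2 * 2)).hom ≤ Submodule.span ℤ {τ} := by
  haveI := hX.smoothOfRelativeDimension
  haveI : Smooth X.hom := SmoothOfRelativeDimension.smooth 3 X.hom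
  -- the bad set `Z₁` off which `C(ℂ)` is straightened (Serre; the tree's theorem)
  obtain ⟨Z₁, hZ₁c, hZ₁C, hZ₁3, hstr⟩ :=
    Literature.AlgebraicGeometry.HodgeTheory.GAGADimension.exists_closed_straightening_off hX hC hC2
  -- `Z₁` is a finite set of closed points
  have hZ₁fin : Z₁.Finite := finite_of_isClosed_of_le_coheight hX hZ₁c hZ₁3
  have hZ₁cl : ∀ z ∈ Z₁, IsClosed ({z} : Set X.left) := fun z hz ↦
    isClosed_singleton_of_le_coheight hX (hZ₁3 z hz)
  -- `(C ∖ Z₁)(ℂ)` is connected: `C` is not contained in `Z₁` (its point of codimension `2`)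
  have hCZ₁ : ¬ C ⊆ Z₁ := by
    obtain ⟨z, hzC, hz2⟩ := hCx
    intro h
    have h3 := hZ₁3 z (h hzC)
    rw [hz2] at h3
    exact absurd h3 (by norm_num)
  have hconn := ComplexPoints.isConnected_setOf_pt_mem_diff_of_isIrreducible X hC hCi hZ₁fin
    hZ₁cl hCZ₁
  exact ker_restrictComplInt_le_span_of_relSingularCohomology_cyclic hX (by norm_num) hZ₁C hZ₁fin
    (by norm_num) (by norm_num) (by norm_num) (htop Z₁ hZ₁c hZ₁C hZ₁fin hZ₁cl hstr hconn)


/-! ### Pinning the normal dimension of the straightening charts: `c' = 2` on a curve -/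

section Pinning

/-- **Invariance of dimension at a point, via local homology**: if a point of a `T₁` space lies in
the sources of charts to `ℝᵐ` and to `ℝᵈ` then `m = d` (`Hₘ(Y | y; ℤ) ≅ Hₘ(ℝᵐ | ·) ≅ ℤ` by the
first chart, `≅ Hₘ(ℝᵈ | ·) = 0` by the second if `m ≠ d`; Hatcher 2002, §3.3 p. 231 and Thm. 2.26).
[cite: HatcherAT2002, §3.3 p. 231 and Thm. 2.26] -/
theorem eq_of_mem_source_openPartialHomeomorph_rvec {Y : Type} [TopologicalSpace Y] [T1Space Y]
    {m d : ℕ} (e : OpenPartialHomeomorph Y (RVec m)) (e' : OpenPartialHomeomorph Y (RVec d))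
    {y : Y} (hy : y ∈ e.source) (hy' : y ∈ e'.source) : m = d := by
  by_contra hmd
  have h0 : Limits.IsZero (localHomology ℤ ℤ Y y m) :=
    (isZero_localHomology_rvec ℤ ℤ (e' y) hmd).of_iso (localHomology.chartIso ℤ ℤ e' hy' m)
  have h1 : Limits.IsZero (ModuleCat.of ℤ (ULift.{0} ℤ)) :=
    h0.of_iso (localHomologyIsoOfChart' ℤ ℤ e hy).symm
  haveI := ModuleCat.subsingleton_of_isZero h1
  exact absurd (Subsingleton.elim (ULift.up (0 : ℤ)) (ULift.up 1)) (by simp)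

/-- **The complex points of a smooth projective threefold form a space of dimension `6` at every
point**: an open partial homeomorphism from `X(ℂ)` to a finite-dimensional real normed space `V`
with non-empty source forces `dim_ℝ V = 6` (the `2n`-manifold structure of `X(ℂ)`,
`Motives.IsSmoothProjective.chartedSpace`, and invariance of dimension). [cite: HatcherAT2002, Thm. 2.26]
[cite: SerreGAGA1956, §2 n°5 Prop. 2] -/
theorem finrank_eq_of_openPartialHomeomorph (hX : IsSmoothProjective n X) {V : Type}
    [NormedAddCommGroup V] [NormedSpace ℝ V] [FiniteDimensional ℝ V]
    (e : OpenPartialHomeomorph (ComplexPoints X) V) {P : ComplexPoints X} (hP : P ∈ e.source) :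
    Module.finrank ℝ V = 2 * n := by
  letI := hX.chartedSpace
  haveI := ComplexPoints.t2Space_of_isSmoothProjective hX
  let c : OpenPartialHomeomorph (ComplexPoints X) (RVec (2 * n)) :=
    (chartAt (EuclideanSpace ℝ (Fin (2 * n))) P).transHomeomorph
      (EuclideanSpace.equiv (Fin (2 * n)) ℝ).toHomeomorph
  let L : V ≃L[ℝ] RVec (Module.finrank ℝ V) := ContinuousLinearEquiv.ofFinrankEq (by simp)
  have hc : P ∈ c.source := by
    rw [OpenPartialHomeomorph.transHomeomorph_source]
    exact mem_chart_source _ P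
  have he : P ∈ (e.transHomeomorph L.toHomeomorph).source := by
    rw [OpenPartialHomeomorph.transHomeomorph_source]
    exact hP
  exact eq_of_mem_source_openPartialHomeomorph_rvec (e.transHomeomorph L.toHomeomorph) c he hc

/-- The real dimension of the model `ℂ^{c'} × K` of a straightening chart. [folklore] -/
theorem finrank_real_prod_submodule (c' : ℕ) {N : ℕ} (K : Submodule ℂ (Fin N → ℂ)) :
    Module.finrank ℝ ((Fin c' → ℂ) × ↥K) = 2 * c' + Module.finrank ℝ ↥K := by
  rw [Module.finrank_prod, Module.finrank_pi_fintype]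
  simp [Complex.finrank_real_complex, mul_comm]

/-- **An irreducible curve has at least two complex points**: with `z ∈ C` of codimension `2`
(not a closed point, `coheight_pt_eq`), the locally closed sets `C` and `C ∖ {pt P₁}` are non-empty,
hence contain complex points (`ComplexPoints.exists_pt_mem`, Nullstellensatz).
[cite: MumfordRedBook1999, I.10] -/
theorem exists_ne_of_curve (hX : IsSmoothProjective 3 X) [LocallyOfFiniteType X.hom]
    {C : Set X.left} (hC : IsClosed C) (hCx : ∃ z ∈ C, Order.coheight z = (2 : ℕ)) :
    ∃ P₁ P₂ : ComplexPoints X, P₁.pt ∈ C ∧ P₂.pt ∈ C ∧ P₁ ≠ P₂ := by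
  obtain ⟨z, hzC, hz2⟩ := hCx
  obtain ⟨P₁, hP₁⟩ := ComplexPoints.exists_pt_mem (X := X) ⟨z, hzC⟩ hC.isLocallyClosed
  have hzP₁ : z ≠ P₁.pt := by
    intro h
    have h3 := Literature.AlgebraicGeometry.HodgeTheory.coheight_pt_eq hX P₁
    rw [← h, hz2] at h3
    exact absurd h3 (by norm_num)
  obtain ⟨P₂, hP₂C, hP₂ne⟩ := ComplexPoints.exists_pt_mem (X := X) (Z := C \ {P₁.pt})
    ⟨z, hzC, hzP₁⟩
    (hC.isLocallyClosed.inter (ComplexPoints.isClosed_pt P₁).isOpen_compl.isLocallyClosed)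
  exact ⟨P₁, P₂, hP₁, hP₂C, fun h ↦ hP₂ne (by rw [← h]; exact Set.mem_singleton _)⟩

/-- **The straightening charts of an irreducible curve have complex normal dimension `2`.** For
`X` a smooth projective threefold, `C ⊆ X` an irreducible closed curve and a chart
`e : X(ℂ) ⇀ ℂ^{c'} × K`, `2 ≤ c'`, at a complex point `P` of `C` straightening `C(ℂ)`
(`pt Q ∈ C ↔ (e Q).1 = 0` on `e.source`): `c' = 2` and `dim_ℝ K = 2`. Indeed `2c' + dim_ℝ K = 6`
(invariance of dimension); if `c' = 3` then `K = 0` and `C(ℂ) ∩ e.source = {P}` would isolate `P`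
in the connected (Shafarevich VII §2 Thm. 7.1) set `C(ℂ)`, which has another point.
[cite: HatcherAT2002, Thm. 2.26] [cite: Shafarevich1994, Book 3 Ch. VII §2 Thm. 7.1] -/
theorem normalDim_eq_two_of_straightening (hX : IsSmoothProjective 3 X)
    {C : Set X.left} (hC : IsClosed C) (hCi : IsIrreducible C)
    (hCx : ∃ z ∈ C, Order.coheight z = (2 : ℕ)) {c' : ℕ} (hc' : 2 ≤ c')
    {K : Submodule ℂ (Fin 3 → ℂ)} (e : OpenPartialHomeomorph (ComplexPoints X) ((Fin c' → ℂ) × ↥K))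
    {P : ComplexPoints X} (hPC : P.pt ∈ C) (hP : P ∈ e.source)
    (he : ∀ Q ∈ e.source, Q.pt ∈ C ↔ (e Q).1 = 0) :
    c' = 2 ∧ Module.finrank ℝ ↥K = 2 := by
  haveI := hX.smoothOfRelativeDimension
  haveI : Smooth X.hom := SmoothOfRelativeDimension.smooth 3 X.hom
  haveI := ComplexPoints.t2Space_of_isSmoothProjective hX
  have hdim := finrank_eq_of_openPartialHomeomorph hX e hP
  rw [finrank_real_prod_submodule] at hdim
  -- `c' ≤ 3`; exclude `c' = 3`
  have hc'3 : c' ≠ 3 := by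
    intro h3
    subst h3
    have hK0 : Module.finrank ℝ ↥K = 0 := by omega
    haveI : Subsingleton ↥K := Module.finrank_zero_iff.1 hK0
    -- `C(ℂ) ∩ e.source = {P}`
    have hiso : ∀ Q ∈ e.source, Q.pt ∈ C → Q = P := by
      intro Q hQ hQC
      refine e.injOn hQ hP (Prod.ext ?_ (Subsingleton.elim _ _))
      rw [(he Q hQ).1 hQC, (he P hP).1 hPC]
    -- but `C(ℂ)` is connected with at least two points
    have hconn := ComplexPoints.isConnected_setOf_pt_mem_of_isIrreducible_holds X hC hCi
    obtain ⟨P₁, P₂, hP₁, hP₂, hne⟩ := exists_ne_of_curve hX hC hCx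
    obtain ⟨P', hP'C, hP'ne⟩ : ∃ P' : ComplexPoints X, P'.pt ∈ C ∧ P' ≠ P := by
      by_cases h : P₁ = P
      · exact ⟨P₂, hP₂, fun h' ↦ hne (h.trans h'.symm)⟩
      · exact ⟨P₁, hP₁, h⟩
    obtain ⟨Q, hQC, hQe, hQP⟩ := hconn.isPreconnected e.source {P}ᶜ e.open_source
      isOpen_compl_singleton (fun Q _ ↦ (em (Q = P)).elim (fun h ↦ Or.inl (h ▸ hP)) Or.inr)
      ⟨P, hPC, hP⟩ ⟨P', hP'C, hP'ne⟩
    exact hQP (hiso Q hQe hQC)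
  refine ⟨by omega, by omega⟩

/-- **Purity for one irreducible curve, reduced to the cyclicity of `H⁴(U, U ∖ S; ℤ)`, with charts
of normal complex dimension exactly `2`.** The same as
`ker_restrictComplInt_le_span_of_straightened_cyclic`, the straightening charts off the finite bad
set `Z₁` being `X(ℂ) ⇀ ℂ² × K` with `dim_ℝ K = 2` (`normalDim_eq_two_of_straightening`) — i.e.
`S = (C ∖ Z₁)(ℂ)` is a closed, connected, locally flat subset of real codimension `4` of the open
`6`-manifold `U = (X ∖ Z₁)(ℂ)`, and the topological input asked for is exactly the degree-`4` step
`H⁴(U, U ∖ S; ℤ) ≅ ℤ` (Thom) above the vanishing `Hq(U, U ∖ S) = 0`, `q < 4`, of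
`AlgebraicTopology/SingularHomology/LocallyFlatComplement`. [cite: VoisinHodgeI2002, §11.1.2 proof of Lemma 11.13]
[cite: SerreGAGA1956, §6 Prop. 3 Cor. 3] [cite: Fulton1998, §19.1 Lemma 19.1.1]
[cite: SouleVoisin2005, §2 Thm. 2] [cite: KollarTrento1992, §1 Lemma p. 134] -/
theorem ker_restrictComplInt_le_span_of_flat_cyclic (hX : IsSmoothProjective 3 X)
    {C : Set X.left} (hC : IsClosed C) (hCi : IsIrreducible C)
    (hC2 : ∀ z ∈ C, ((2 : ℕ) : ℕ∞) ≤ Order.coheight z) (hCx : ∃ z ∈ C, Order.coheight z = (2 : ℕ))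
    (htop : ∀ Z₁ : Set X.left, IsClosed Z₁ → Z₁ ⊆ C → Z₁.Finite →
      (∀ z ∈ Z₁, IsClosed ({z} : Set X.left)) →
      (∀ P : ComplexPoints X, P.pt ∈ C → P.pt ∉ Z₁ →
        ∃ (K : Submodule ℂ (Fin 3 → ℂ))
          (e : OpenPartialHomeomorph (ComplexPoints X) ((Fin 2 → ℂ) × K)),
          Module.finrank ℝ ↥K = 2 ∧ P ∈ e.source ∧ ∀ Q ∈ e.source, Q.pt ∈ C ↔ (e Q).1 = 0) →
      IsConnected {P : ComplexPoints X | P.pt ∈ C ∧ P.pt ∉ Z₁} →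
      ∃ θ : relSingularCohomology ℤ ℤ (complexPointsCompl X Z₁)
          {Q : complexPointsCompl X Z₁ | Q.1.pt ∉ C} (2 * 2),
        ∀ y, y ∈ Submodule.span ℤ ({θ} : Set (relSingularCohomology ℤ ℤ (complexPointsCompl X Z₁)
          {Q : complexPointsCompl X Z₁ | Q.1.pt ∉ C} (2 * 2)))) :
    ∃ τ : bettiCohomologyInt X (2 * 2),
      LinearMap.ker (restrictComplInt X C (2 * 2)).hom ≤ Submodule.span ℤ {τ} := by
  refine ker_restrictComplInt_le_span_of_straightened_cyclic hX hC hCi hC2 hCx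
    fun Z₁ hZ₁c hZ₁C hZ₁f hZ₁cl hstr hconn ↦ htop Z₁ hZ₁c hZ₁C hZ₁f hZ₁cl (fun P hPC hPZ ↦ ?_) hconn
  obtain ⟨c', K, e, hc', hP, he⟩ := hstr P hPC hPZ
  obtain ⟨rfl, hK⟩ := normalDim_eq_two_of_straightening hX hC hCi hCx hc' e hPC hP he
  exact ⟨K, e, hK, hP, he⟩

end Pinning

end HodgeConjecture
end Barriers

end Literature.Barriers.HodgeConjecture

end
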